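import Mathlib
import HarnessLib
import Summits.Langlands.Langlands.Statement
import Literature.NumberTheory.GaloisRepresentations.OrdinaryGaloisRep
import Literature.NumberTheory.EllipticCurves.NewformGaloisRep
import Literature.NumberTheory.Automorphic.AutomorphicRepsGL
import Literature.NumberTheory.Automorphic.GLnAdelicStructure
import Literature.NumberTheory.Automorphic.InfinityType
import Literature.FieldTheory.AlgClosed.PadicAlgClEquivComplex
import Summits.Langlands.Langlands.Theorems.SkinnerWilesDefectOneEisensteinProModularSeedLevelRaisedEisensteinNewformQFrame
import Summits.Langlands.Langlands.Theorems.SkinnerWilesDefectOneEisensteinProModularSeedLevelRaisedEisensteinNewformQInertia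
import Summits.Langlands.Langlands.Theorems.SkinnerWilesDefectOneEisensteinProModularSeedLevelRaisedEisensteinNewformQGlue
import Literature.NumberTheory.EllipticCurves.EisensteinNewformLevelRaising

/-!
# `EisensteinProModularSeed` (stmt-Langlands-12920), line `descend-raise-basechange`:
# stub S2 `stub_levelRaisedEisensteinNewformQ` — the `ℚ`-side package (CONDITIONAL)

The registered stub (for `p ≥ 5`, `O = 𝒪_{ℚ̄_p}`, an odd unit-valued continuous `η : Γ_ℚ → ℚ̄_pˣ` in the
Serre-weight window and a Billerey–Menares prime `M`: `k ≥ 2`, an irreducible `ρ'` with an integral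
model of ORDERED residual diagonal `(1, η̄)`, an ORIENTED ordinary frame at `p` of inertial type
`(ε^{k-1}, 1)`, the level property off `Mp`, and the modularity clause) is proved CONDITIONALLY on five
published theorems absent from the tree, stated inline as named facts (relocated to `Literature/` by
the gate) and PREPENDED as hypotheses in this order: `BillereyMenares2018_exists_newform` (BM 2018
Thms. 1–2 + Mazur: the Eisenstein-congruent newform `g`), `Hida2000_thm326_exists_galoisRep` (Hida,
*MFG* Thm. 3.26 (1): `ρ_{g,ι}` over `ℚ̄_p`), `Hida2000_thm326_ordinary` (Thm. 3.26 (2): the ordinary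
filtration at `p`), `Hida2000_thm326_inertia_of_level` (Thm. 3.26 (3)(a): inertia at `ℓ ∣ N` with
`v_ℓ(N) = v_ℓ(cond χ)`), `Gelbart1975_exists_cuspidalRepData_LAlgebraic` (Gelbart Thm. 5.19: the
L-algebraic cuspidal `π` of `g`).  Everything else is PROVED in the support files `…Frame` (Ribet's
lattice in elementary form, the tautological orientation), `…Inertia` (the Serre weight from the
window, local Kronecker–Weber), `…Glue` (Chebotarev, change of frame, Satake, the level step).
-/

set_option linter.dupNamespace false -- project-wide option (lakefile weak.linter.dupNamespace); `Summit.Langlands.Langlands` is the mandated namespace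

noncomputable section

namespace Summit.Langlands.Langlands.Theorems.SkinnerWilesDefectOne.EisensteinProModularSeed

open Literature.NumberTheory.GaloisRepresentations Literature.NumberTheory.Automorphic
open Literature.NumberTheory.EllipticCurves.ModularForms NumberField IsDedekindDomain
open scoped MatrixGroups Matrix

/-! ### The five named facts (published theorems not yet in the tree) -/

section Facts

end Facts

/-! ### The stub, conditional on the five named facts -/

section Main

/-- **stub_levelRaisedEisensteinNewformQ** (line `descend-raise-basechange`, S2 — the `ℚ`-side package),
CONDITIONAL on the five named facts above, prepended in the order BM → Hida (1) → Hida (2) → Hida (3a)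
→ Gelbart.  Proof: the Serre weight `k` from the window (`exists_weight_of_window`); the newform `g`;
`ρ = ρ_{g,ι}`; `tr ρ ≡ 1 + η`, `det ρ ≡ η` on `Γ_ℚ` (`trace_det_congr_of_newform`); the ordinary frame
at `p`, diagonalised at a window element (`exists_unipotent_diag_frame`) and made integral and
residually Borel with ORDERED diagonal `(1, η̄)` (`exists_residually_borel_frame`), in which frame the
ordinary frame is ORIENTED; (lev) by `apply_eq_one_of_conj_eq_diagonal`; (mod) by `satakeFrobCompatibleAt_of_newform`. -/
theorem stub_levelRaisedEisensteinNewformQ :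
    Literature.NumberTheory.EllipticCurves.BillereyMenares2018_exists_newform → Literature.NumberTheory.EllipticCurves.Hida2000_thm326_exists_galoisRep →
    Literature.NumberTheory.EllipticCurves.Hida2000_thm326_ordinary → Literature.NumberTheory.EllipticCurves.Hida2000_thm326_inertia_of_level →
    Literature.NumberTheory.EllipticCurves.Gelbart1975_exists_cuspidalRepData_LAlgebraic →
    ∀ (p : ℕ) [Fact p.Prime], 5 ≤ p → ∀ (O : ValuationSubring (PadicAlgCl p)),
      O = (Valued.v : Valuation (PadicAlgCl p) NNReal).valuationSubring →
      ∀ (η : Field.absoluteGaloisGroup ℚ →ₜ* (PadicAlgCl p)ˣ) (M : ℕ),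
      (∀ τ, Valued.v ((η τ : (PadicAlgCl p)ˣ) : PadicAlgCl p) = 1) →
      (∀ c : Field.absoluteGaloisGroup ℚ, Literature.NumberTheory.GaloisRepresentations.IsComplexConjugation (Rat.castHom ℝ) c →
        Valued.v (((η c : (PadicAlgCl p)ˣ) : PadicAlgCl p) + 1) < 1) →
      (∀ w : IsDedekindDomain.HeightOneSpectrum (NumberField.RingOfIntegers ℚ), (p : NumberField.RingOfIntegers ℚ) ∈ w.asIdeal → ∀ 𝔓 ∈ w.primesAbove,
        (∃ σ ∈ 𝔓.inertia (Field.absoluteGaloisGroup ℚ),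
          ¬ Valued.v (((η σ : (PadicAlgCl p)ˣ) : PadicAlgCl p) - 1) < 1) ∧
        (∃ σ ∈ 𝔓.inertia (Field.absoluteGaloisGroup ℚ),
          ¬ Valued.v (((η σ : (PadicAlgCl p)ˣ) : PadicAlgCl p) * (algebraMap (Padic p) (PadicAlgCl p) (((Literature.NumberTheory.GaloisRepresentations.GaloisRep.cyclotomicCharacter ℚ p σ).val : PadicInt p) : Padic p)) - 1) < 1)) →
      M.Prime → M ≠ p →
      (∀ w : IsDedekindDomain.HeightOneSpectrum (NumberField.RingOfIntegers ℚ), (M : NumberField.RingOfIntegers ℚ) ∈ w.asIdeal → ∀ 𝔓 ∈ w.primesAbove,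
        ∀ σ ∈ 𝔓.inertia (Field.absoluteGaloisGroup ℚ),
          Valued.v (((η σ : (PadicAlgCl p)ˣ) : PadicAlgCl p) - 1) < 1) →
      (∀ w : IsDedekindDomain.HeightOneSpectrum (NumberField.RingOfIntegers ℚ), (M : NumberField.RingOfIntegers ℚ) ∈ w.asIdeal → ∀ 𝔓 ∈ w.primesAbove,
        ∀ σ : Field.absoluteGaloisGroup ℚ, IsArithFrobAt (NumberField.RingOfIntegers ℚ) σ 𝔓 →
          Valued.v (((η σ : (PadicAlgCl p)ˣ) : PadicAlgCl p) * (M : PadicAlgCl p) - 1) < 1) →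
      ((∀ τ, Valued.v (((η τ : (PadicAlgCl p)ˣ) : PadicAlgCl p) - (algebraMap (Padic p) (PadicAlgCl p) (((Literature.NumberTheory.GaloisRepresentations.GaloisRep.cyclotomicCharacter ℚ p τ).val : PadicInt p) : Padic p))) < 1) → M % p = 1) →
      ∃ (k : ℕ) (ρ' : Literature.NumberTheory.GaloisRepresentations.FramedGaloisRep ℚ (PadicAlgCl p) 2)
        (ρ'₀ : Field.absoluteGaloisGroup ℚ →* Matrix.GeneralLinearGroup (Fin 2) O),
        2 ≤ k ∧ ρ'.toGaloisRep.IsIrreducible ∧ ρ'.HasUpperTriangularIntegralModel ρ'₀ ∧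
        (∀ g, ((ρ'₀ g).val 0 0 - 1 : O) ∈ IsLocalRing.maximalIdeal O ∧
          Valued.v (((ρ'₀ g).val 1 1 : PadicAlgCl p) - ((η g : (PadicAlgCl p)ˣ) : PadicAlgCl p)) < 1) ∧
        (∀ w : IsDedekindDomain.HeightOneSpectrum (NumberField.RingOfIntegers ℚ), (p : NumberField.RingOfIntegers ℚ) ∈ w.asIdeal →
          ∃ Q : Matrix.GeneralLinearGroup (Fin 2) (PadicAlgCl p),
            Valued.v (Q.val 0 0) ≤ Valued.v (Q.val 1 0) ∧
            ∀ σ, (Q⁻¹ * ρ'.toLocal w σ * Q).val 1 0 = 0 ∧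
              (σ ∈ Literature.NumberTheory.GaloisRepresentations.absInertia (w.adicCompletion ℚ) →
                (Q⁻¹ * ρ'.toLocal w σ * Q).val 1 1 = 1 ∧
                (Q⁻¹ * ρ'.toLocal w σ * Q).val 0 0 =
                  algebraMap (Padic p) (PadicAlgCl p)
                    (((Literature.NumberTheory.GaloisRepresentations.GaloisRep.cyclotomicCharacter (w.adicCompletion ℚ) p σ).val : PadicInt p) :
                      Padic p) ^ (k - 1))) ∧
        (∀ w : IsDedekindDomain.HeightOneSpectrum (NumberField.RingOfIntegers ℚ), (M : NumberField.RingOfIntegers ℚ) ∉ w.asIdeal → (p : NumberField.RingOfIntegers ℚ) ∉ w.asIdeal →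
          ∀ 𝔓 ∈ w.primesAbove, ∀ σ ∈ 𝔓.inertia (Field.absoluteGaloisGroup ℚ),
            Valued.v (((η σ : (PadicAlgCl p)ˣ) : PadicAlgCl p) - 1) < 1 → ρ' σ = 1) ∧
        ∀ hcpt : Literature.NumberTheory.Automorphic.isCompact_glFiniteIntegralLevel 2 ℚ,
          ∃ (ι : PadicAlgCl p ≃+* ℂ) (π : Literature.NumberTheory.Automorphic.CuspidalAutomorphicRepData 2 ℚ hcpt) (T : Literature.NumberTheory.Automorphic.InfinityType ℚ 2),
            π.1.HasInfinityType T ∧ T.IsLAlgebraic ∧ T.IsRegular ∧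
            ∀ᶠ w in Filter.cofinite, Summit.Langlands.SatakeFrobCompatibleAt ι π.1 ρ' w := by
  intro hBM hDel hOrd hLev hGel p hp hp5 O hO η M hunit hodd hwin hMp hMne hMunr hMcong hMazur
  classical
  have hpp : p.Prime := hp.out
  have hp2 : p ≠ 2 := by omega
  -- an abstract field isomorphism `ι : ℚ̄_p ≃ ℂ`, and the place `w₀ ∣ p`
  obtain ⟨ι⟩ := PadicAlgCl.nonempty_ringEquiv_complex p
  set w₀ : HeightOneSpectrum (𝓞 ℚ) := (Rat.HeightOneSpectrum.primesEquiv (R := 𝓞 ℚ)).symm ⟨p, hpp⟩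
    with hw₀
  have hw₀p : ((Rat.HeightOneSpectrum.primesEquiv w₀ : Nat.Primes) : ℕ) = p := by
    rw [hw₀, Equiv.apply_symm_apply]
  have hpw₀ : (p : 𝓞 ℚ) ∈ w₀.asIdeal := (natCast_mem_asIdeal_iff_primesEquiv w₀ hpp).mpr hw₀p
  have hw_eq : ∀ w : HeightOneSpectrum (𝓞 ℚ), (p : 𝓞 ℚ) ∈ w.asIdeal → w = w₀ := fun w hw =>
    Rat.HeightOneSpectrum.primesEquiv.injective (Subtype.ext (by
      rw [(natCast_mem_asIdeal_iff_primesEquiv w hpp).mp hw, hw₀p]))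
  -- STEP 1: the weight `k` (local Kronecker–Weber)
  obtain ⟨k, hk2, hkp, 𝔓₁, h𝔓₁, hinert⟩ :=
    exists_weight_of_window p hp2 η hunit w₀ hpw₀ (hwin w₀ hpw₀)
  -- STEP 2: the Eisenstein-congruent newform (Billerey–Menares / Mazur)
  obtain ⟨N, hN, g, hnew, hpN, hlevel, ⟨m, -, hpm, hχm⟩, hap, hcong⟩ :=
    hBM p hp5 ι η k M hunit hodd hk2 hkp
      (fun w hw => by obtain rfl := hw_eq w hw; exact ⟨𝔓₁, h𝔓₁, hinert⟩) hMp hMne hMunr hMcong hMazur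
  haveI := hN
  have hk2' : (2 : ℤ) ≤ (k : ℤ) := by exact_mod_cast hk2
  -- STEP 3: Deligne's representation `ρ = ρ_{g,ι}` and the congruences on all of `Γ_ℚ`
  obtain ⟨ρ, hρg, hirr⟩ := hDel g hk2' hnew p ι
  have hirr' : FramedRep.IsIrreducible ρ := hirr
  obtain ⟨htrall, -⟩ := trace_det_congr_of_newform g ι ρ hρg
    (fun σ => ((η σ : (PadicAlgCl p)ˣ) : PadicAlgCl p)) (Units.continuous_val.comp η.continuous) hcong
  -- STEP 4: the ordinary frame at `p` (Mazur–Wiles)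
  obtain ⟨Q, hQ⟩ := hOrd g hk2' hnew p ι hpN (v_eq_one_of_sub_one_lt hap) ρ hρg hirr w₀ hpw₀
  -- STEP 5: a window element `τ₀ = res σ₀` in the local inertia group; diagonalise there
  obtain ⟨𝔓₀, h𝔓₀, hlift, -⟩ := exists_primesAbove_inertia_eq_absGaloisRestrict w₀
  obtain ⟨⟨τ₀, hτ₀I, hτ₀⟩, -⟩ := hwin w₀ hpw₀ 𝔓₀ h𝔓₀
  obtain ⟨σ₀, hσ₀, rfl⟩ := hlift τ₀ hτ₀I
  obtain ⟨hS10, hSin⟩ := hQ σ₀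
  obtain ⟨U, hU10, h01, h10, h11⟩ := exists_unipotent_diag_frame ρ η htrall Q
    (absGaloisRestrict ℚ (w₀.adicCompletion ℚ) σ₀) hS10 (hSin hσ₀).1 hτ₀
  -- STEP 6: Ribet's frame and the integral model
  obtain ⟨D, hD00, hframe⟩ := exists_residually_borel_frame ρ hirr' η hunit htrall (Q * U)
    (absGaloisRestrict ℚ (w₀.adicCompletion ℚ) σ₀) h01 h10 h11 hτ₀
  set P := Q * U * D with hP
  have hρ'apply : ∀ σ, FramedRep.conj P⁻¹ ρ σ = P⁻¹ * ρ σ * P := fun σ => conj_inv_apply ρ P σ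
  obtain ⟨ρ'₀, hmodel, hdiag⟩ := exists_integralModel_of_frame hO ρ
    (fun σ => ((η σ : (PadicAlgCl p)ˣ) : PadicAlgCl p)) P
    (fun σ i j => (hframe σ).1 i j) (fun σ => (hframe σ).2.1) (fun σ => (hframe σ).2.2.1)
    (fun σ => (hframe σ).2.2.2)
  refine ⟨k, FramedRep.conj P⁻¹ ρ, ρ'₀, hk2, isIrreducible_conj ρ P⁻¹ hirr', hmodel, hdiag,
    ?_, ?_, ?_⟩
  · -- (ord): the ordinary frame `Q`, transported to the new frame, is oriented tautologically
    intro w hw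
    obtain rfl := hw_eq w hw
    refine ⟨P⁻¹ * Q, ?_, fun σ => ?_⟩
    · have hPQ : P⁻¹ * Q = D⁻¹ * U⁻¹ := by rw [hP]; group
      have h00 : (P⁻¹ * Q).val 0 0 = 0 := by
        rw [hPQ, Units.val_mul, Matrix.mul_apply, Fin.sum_univ_two, hD00, hU10, zero_mul, mul_zero,
          add_zero]
      rw [h00, Valuation.map_zero]
      exact zero_le
    · have hconj : (P⁻¹ * Q)⁻¹ * FramedGaloisRep.toLocal w₀ (FramedRep.conj P⁻¹ ρ) σ * (P⁻¹ * Q) =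
          Q⁻¹ * ρ.toLocal w₀ σ * Q := by
        rw [FramedGaloisRep.toLocal_apply, FramedGaloisRep.toLocal_apply, hρ'apply]; group
      rw [hconj]
      obtain ⟨hq10, hqin⟩ := hQ σ
      refine ⟨hq10, fun hσ => ⟨(hqin hσ).1, ?_⟩⟩
      rw [(hqin hσ).2, show ((k : ℤ) - 1) = ((k - 1 : ℕ) : ℤ) by
        rw [Nat.cast_sub (by omega : 1 ≤ k)]; norm_num, zpow_natCast]
  · -- (lev): inertia at `ℓ ∤ Mp` killed by `η̄` acts trivially
    intro w hwM hwp 𝔓 h𝔓 σ hσI hησ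
    suffices hρσ : ρ σ = 1 by rw [hρ'apply, hρσ, mul_one, inv_mul_cancel]
    set ℓ := ((Rat.HeightOneSpectrum.primesEquiv w : Nat.Primes) : ℕ) with hℓ
    have hℓprime : ℓ.Prime := (Rat.HeightOneSpectrum.primesEquiv w).2
    have hℓp : ℓ ≠ p := fun h => hwp ((natCast_mem_asIdeal_iff_primesEquiv w hpp).mpr h)
    have hℓM : ℓ ≠ M := fun h => hwM ((natCast_mem_asIdeal_iff_primesEquiv w hMp).mpr h)
    by_cases hℓN : ℓ ∣ N
    · -- Langlands–Carayol at `ℓ ∣ N`, `v_ℓ(N) = v_ℓ(cond χ)`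
      haveI : Fact ℓ.Prime := ⟨hℓprime⟩
      have hval : padicValNat ℓ N = padicValNat ℓ (nebentypus g).conductor := by
        rcases hlevel with h | h
        · rw [← h]
        · conv_lhs => rw [h]
          rw [padicValNat.mul (DirichletCharacter.conductor_ne_zero _) hMp.ne_zero,
            padicValNat.eq_zero_of_not_dvd
              (fun hd => hℓM ((Nat.prime_dvd_prime_iff_eq hℓprime hMp).mp hd)), add_zero]
      obtain ⟨Pℓ, hPℓ⟩ := hLev g hk2' hnew p ι ρ hρg hirr ℓ hℓprime hℓp hℓN hval w
        ((natCast_mem_asIdeal_iff_primesEquiv w hℓprime).mpr rfl) 𝔓 h𝔓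
      obtain ⟨a, ha⟩ := hPℓ σ hσI
      refine apply_eq_one_of_conj_eq_diagonal ρ σ Pℓ _ _ ha (htrall σ) hησ hpm ?_
      rw [← map_pow, ← MulChar.pow_apply_coe, hχm, MulChar.one_apply_coe, map_one]
    · -- `ρ` is unramified at `ℓ ∤ Np`
      refine (hρg w fun h => ?_).1 𝔓 h𝔓 σ hσI
      rcases (Nat.Prime.dvd_mul hℓprime).mp h with h' | h'
      · exact hℓN h'
      · exact hℓp ((Nat.prime_dvd_prime_iff_eq hℓprime hpp).mp h')
  · -- (mod): the L-algebraic cuspidal `π` of `g`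
    intro hcpt
    obtain ⟨π, hπT, hSat⟩ := hGel g hk2' hnew hcpt
    obtain ⟨hLalg, hreg⟩ := isLAlgebraic_isRegular_weight (k : ℤ) (by omega)
    refine ⟨ι, π, _, hπT, hLalg, hreg, ?_⟩
    rw [Filter.eventually_cofinite]
    refine (finite_setOf_primesEquiv_dvd (mul_ne_zero (NeZero.ne N) hpp.ne_zero)).subset
      fun w hw => ?_
    by_contra hwS
    apply hw
    have hprime := (Rat.HeightOneSpectrum.primesEquiv w).2
    have hndvd : ¬ ((Rat.HeightOneSpectrum.primesEquiv w : Nat.Primes) : ℕ) ∣ N * p := hwS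
    obtain ⟨α, hα, hpoly⟩ := hSat _ hprime (fun h => hndvd (h.mul_right p)) w
      ((natCast_mem_asIdeal_iff_primesEquiv w hprime).mpr rfl)
    obtain ⟨hunr, hfrob⟩ := hρg w hndvd
    exact satakeFrobCompatibleAt_of_newform g ι π _ w _ α hα hpoly
      ((FramedGaloisRep.isUnramifiedAt_conj_iff w P⁻¹ ρ).mpr hunr)
      ((hasFrobCharpolyAt_conj_iff w P⁻¹ ρ _).mpr hfrob)

end Main

end Summit.Langlands.Langlands.Theorems.SkinnerWilesDefectOne.EisensteinProModularSeed
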